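import Summits.QuantumFields.YangMills.Theorems.BalabanUVNodesK0V23Stub3RunwiseSuppliers
import Summits.QuantumFields.YangMills.Theorems.BalabanUVNodesN22KernelsBetaHistLipschitz

/-!
# K0⁷ V23 — RUNS ⟹ BOX ON THE V23 ROAD, modulo the K3∕N22 kernel letters: the run-wise core (dag-n07-w3's currency) and N22's history-Lipschitz road at the print-regime Z3 members
# give back the BOX core and the door boxes — so under the kernel letters the run socket and the box socket (stub 3ᴬ′ᴮ) are ONE debt; and NOT without letters (a bare `HBeta` witness)

Cell `pub-ymgap`, seat `pub-ymgap-k0-s1-w3` (g9) placed as «n07-w3-b» (dag-lead g34 PLACEMENT 1; dag-n07-w3 g16 AGREE I.18512 «and, if wanted, the `K0Stub3RunFaceBoxEquivalence` twin»):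
the V23 twin of k0-s3-w1's residue `…K0Stub3RunFaceBoxEquivalence` (V19-keyed; imports `…K0V19Defs` ∕ `…K0Stub3RunwiseFace` — red after the Stage-2 seam — and DEF-1's run letter
`…K2NamedJetsRunRemAt`, which sits in the theses cone).  `--kind proof --supports stmt-QuantumFields-20541 --as helper`, COUNT-NEUTRAL.  NEW leaf; theorems only — 0 `def`,
0 `sorry`, 0 `instance`, 0 `notation`.  Imports ONLY route-independent, residue-free green modules: dag-n07-w3's `…K0V23Stub3RunwiseSuppliers` (✓p771242; through it `…K0V23Defs`,
DEF-1's Z3 letters, node O P3's window arithmetic, the tree's `FlowStep ∕ FlowStepRuns`) and dag-n22-w3's `…N22KernelsBetaHistLipschitz` (`YMDAG.N22.AtKernels.histLipschitz_betaOfRecord₁₃_of_kernelNE9`,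
`fadingMemory_histModuli_of_fadingMemory`; through it W1-19 `Node00/U3OfKernels`, t4's `T4CouplingMatching` ∕ `T4OutputRate`).  The run letter is DISPLAYED UNFOLDED in
dag-n07-w3's sign-free form `∀ n gs, RGEqH n β gs → Step.InInterval γ₀ n gs → ∀ k ≤ n, |β k (prefixOf gs k)| ≤ β′` (= DEF-1's `RunConstRemainder β 0 β′ γ₀` up to `sub_zero`), so no
theses-cone module is imported; the residue's three generic box lemmas are re-homed `private` (director-ym №366 R2); every PUBLIC statement is new (run-ABS currency ∕ Z3-keyed).
[I] = [Balaban1987RG1]; [II] = [Balaban1989LargeFieldII]; [III] = [Balaban1988Convergent]; [15] = [Balaban1985Variational]; [RG2] = [Balaban1988RG2Cluster].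

WHY.  The registered V23 stub 3ᴬ′ᴮ bounds β₁₃ at the print-regime member on the whole history BOX `]0, γ₀]^{k+1}`; dag-n07-w3's run road (✓p771242) bounds it only ALONG THE IN-WINDOW
SOLUTIONS OF (0.20) — and suffices for K0⁷ — with «box ⟹ runs» trivial (`runAbsBound_of_absBox`).  THIS FILE proves the CONVERSE modulo letters the K3 side already carries at the
same θ: N22's kernel-currency NE9 with node-U3 fading-memory moduli and the (D4) letter `U3OfKernels.KernelDecayOfRecord₁₃` make β₁₃(θ) history-LIPSCHITZ on the box with k-SUMMABLE
moduli (dag-n22-w3, BY NAME); the run letter supplies, at every level `k`, ONE reference history in the box where `|β| ≤ β′` — the prefix of an in-window run of length `k`, which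
EXISTS because the run letter itself lets one build such runs from a small bare coupling (§1, induction on (0.20)); hence `|β| ≤ β′ + γ₀·(sum of moduli)` on the whole box.  At the
Z3 members β is letter-blind (dag-n07-w3's census, `rfl`), so the kernel letters may be certified at ANY one member per `(a₀, ε₂₉)`.

CONTENTS (kernel-checked; CONDITIONAL — the run letter and every kernel letter DISPLAYED, inhabited nowhere).
§1 ★ `exists_inInterval_genSeq_of_runAbsBound` (runs of every length `n` in `]0, γ₀]` from `g₀ = (γ₀⁻² + (n+1)β′)^{−1/2}`).  §2 ★ `absBetaBox_of_runAbsBound_of_histLipschitz` (one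
reference history + history-Lipschitz moduli with rows summing to `≤ S` ⟹ the sign-free box `β′ + γ₀·S`).  §3 θ-generic at the record: `absBetaBox_betaOfRecord₁₃_of_runAbs_of_histLipschitz`
(K2-side currency: `HistLipschitz` + fading memory), ★★ `absBetaBox_betaOfRecord₁₃_of_runAbs_of_kernelNE9` (K3∕N22 currency: NE9 of `(objectsOfRecord₁₃ θ ℓ).EA 0` + (D4) + fading
memory).  §4 at the print-regime Z3 members: ★★ `absBoxZBAt_of_runAbsBoxZB_of_kernelLetters` (a door's run letter `h3R` of ✓p771242 §3 + the kernel letters at the half-window member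
⟹ the door's box `h3A` of `…ZBLam` §4, window `min γ₀ ½`), ★★★ `tokenFreeZB_of_runwiseZB_of_kernelLettersAt` (the RUN-WISE CORE + kernel letters at one member per `(a₀, ε₂₉)` ⟹ the
BOX CORE of ✓p770586∕p770587 — the converse of ✓p771242 §5 `runwiseZB_of_tokenFreeZB`).  §5 sharpness ★ `exists_hbeta_runAbs_not_box` — a bare `HBeta` meeting the run letter with
`β′ = 0` on every window yet unbounded on every box: without regularity letters «runs ⟹ box» FAILS, so the kernel letters of §3–§4 do real work.

HONEST FRAMING (binding).  Elementary real arithmetic on (0.20) and on Lipschitz sums + by-name composition over LANDED bookkeeping (dag-n22-w3's history-Lipschitz road, itself over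
t4∕pv10's dominated summation); NOTHING of Bałaban's analysis is asserted or proved: the run letter (NODE O's wall read along runs, [I] Thm 3 p.264 ∕ §1 p.264 — «uniformly
bounded» STATED, proof unpublished [II] p.355), kernel-currency NE9 (NOT printed for d = 4), the (D4) letter at the record and the fading-memory moduli are HYPOTHESES; stub 3ᴬ′ᴮ
NOT proved; V23 NOT registered; K0⁷ stmt-QuantumFields-20541 NOT closed; N07 NOT discharged; K1⁹ ∕ K3⁸ OPEN; counts UNMOVED (typed 28∕28 · discharged 8∕28, route display 8∕27 excl.
NODE O; K 1∕4); R4 = the CONDITIONAL finite-𝕋⁴ rung `BalabanLadder.UV` at fixed `ε = L^(−K)` only — NOTHING about the continuum limit, ℝ⁴, OS axioms, a mass gap or the Clay problem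
is proved or claimed.  No `sorry`, `def`, `instance`, `notation`, `axiom`; standard axioms.
-/

noncomputable section

open scoped Matrix.Norms.L2Operator BigOperators
open Finset

namespace Summit.QuantumFields.YangMills.Theorems.K0V23Stub3RunBoxEquivalence

open Literature.MathematicalPhysics.QuantumFieldTheory.Balaban1983to89
open Literature.MathematicalPhysics.QuantumFieldTheory.Balaban1983to89.Node00
open Literature.MathematicalPhysics.QuantumFieldTheory.Balaban1983to89.T4Continuum
open Literature.MathematicalPhysics.QuantumFieldTheory.Balaban1983to89.FlowStep
open Literature.MathematicalPhysics.QuantumFieldTheory.Balaban1983to89.FlowStepRuns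
open Literature.MathematicalPhysics.QuantumFieldTheory.Balaban1983to89.T4OutputRate (Window NE9)
open Literature.MathematicalPhysics.QuantumFieldTheory.Balaban1983to89.T4CouplingMatching (HistLipschitz)
open Literature.MathematicalPhysics.QuantumFieldTheory.Balaban1983to89.B12Sec2to5 (betaPrime510)
open Literature.MathematicalPhysics.QuantumFieldTheory.Balaban1983to89.Node00.U3OfKernels (objectsOfRecord₁₃ KernelDecayOfRecord₁₃)
open YMDAG.N22.AtKernels (histLipschitz_betaOfRecord₁₃_of_kernelNE9 fadingMemory_histModuli_of_fadingMemory)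
open Summit.QuantumFields.YangMills.Theorems.K0V23Stub3RunwiseSuppliers (nonneg_of_runAbsBound runAbsBound_mono runAbsBound_of_absBox)

/-! ## §1  Generic (0.20) arithmetic: the run letter lets one BUILD in-window runs of every length -/
section Runs

variable {β : HBeta}

/-- An in-window generated run solves (0.20) (k0-s3-w2's raw-sequence form, re-homed `private`). [cite: Balaban1987RG1, (0.18)–(0.20) pp.255–256] -/
private theorem rgEqH_genSeq_of_inInterval' {g0 γ : ℝ} {n : ℕ} (hI : Step.InInterval γ n (genSeq β g0)) : RGEqH n β (genSeq β g0) := by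
  intro k hk
  have hpos : 0 < genSeq β g0 (k + 1) := (hI (k + 1) (Nat.succ_le_of_lt hk)).1
  have h := inv_sq_genSeq_succ β g0 hpos
  rw [one_div, one_div, h]
  ring

/-- **★ (i) THE RUN LETTER FORCES IN-WINDOW RUNS OF EVERY LENGTH**: if `|β_k(g₀,…,g_{k−1})| ≤ β′` at every prefix `k ≤ n` of every solution of (0.20) up to `n` staying in `]0, γ₀]`
(dag-n07-w3's run currency; `γ₀ > 0`), then for every `n` the run generated from the bare coupling `g₀` with `g₀⁻² = γ₀⁻² + (n+1)·β′` stays in `]0, γ₀]` up to `n`: by induction on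
(0.20), `g_m⁻² ≥ γ₀⁻² + (n+1−m)·β′` — the β read at step `m` is the β of the run built so far, which the letter bounds (`0 ≤ β′` is forced). [cite: Balaban1987RG1, (0.18)–(0.20) pp.255–256, Thm 3 p.264] -/
theorem exists_inInterval_genSeq_of_runAbsBound {β' γ₀ : ℝ} (hγ₀ : 0 < γ₀)
    (h : ∀ (n : ℕ) (gs : ℕ → ℝ), RGEqH n β gs → Step.InInterval γ₀ n gs → ∀ k, k ≤ n → |β k (prefixOf gs k)| ≤ β') (n : ℕ) :
    ∃ g0 : ℝ, Step.InInterval γ₀ n (genSeq β g0) := by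
  have hβ' : 0 ≤ β' := nonneg_of_runAbsBound hγ₀ h
  set T : ℝ := 1 / γ₀ ^ 2 + ((n : ℝ) + 1) * β' with hT
  have hγsq : 0 < 1 / γ₀ ^ 2 := by positivity
  have hTpos : 0 < T := by positivity
  refine ⟨solveCoupling T, ?_⟩
  set g : ℕ → ℝ := genSeq β (solveCoupling T) with hg
  -- invariant: in the window up to `m` and `1/g_m² ≥ 1/γ₀² + (n+1−m)·β′`
  have key : ∀ m, m ≤ n → Step.InInterval γ₀ m g ∧ 1 / γ₀ ^ 2 + ((n : ℝ) + 1 - m) * β' ≤ 1 / (g m) ^ 2 := by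
    intro m
    induction m with
    | zero =>
      intro _
      have hg0 : g 0 = solveCoupling T := by rw [hg, genSeq_zero]
      have hpos : 0 < g 0 := by rw [hg0]; exact solveCoupling_pos hTpos
      have hinv : 1 / (g 0) ^ 2 = T := by rw [hg0]; exact inv_sq_solveCoupling hTpos
      have hle : g 0 ≤ γ₀ := by
        refine (pow_le_pow_iff_left₀ hpos.le hγ₀.le two_ne_zero).1 ((one_div_le_one_div (pow_pos hγ₀ 2) (pow_pos hpos 2)).1 ?_)
        rw [hinv, hT]
        nlinarith
      refine ⟨fun k hk => ?_, ?_⟩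
      · obtain rfl : k = 0 := Nat.le_zero.mp hk
        exact ⟨hpos, hle⟩
      · rw [hinv, hT]; push_cast; nlinarith
    | succ m ih =>
      intro hm1
      obtain ⟨hIm, hinvm⟩ := ih (Nat.le_of_succ_le hm1)
      have hgm : 0 < g m := (hIm m le_rfl).1
      have hrg : RGEqH m β g := rgEqH_genSeq_of_inInterval' hIm
      have hβm : |β m (prefixOf g m)| ≤ β' := h m g hrg hIm m le_rfl
      have hβm' := (abs_le.mp hβm).2
      set y : ℝ := 1 / (g m) ^ 2 - β m (prefixOf g m) with hy
      have hmn : (m : ℝ) + 1 ≤ n := by exact_mod_cast hm1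
      have hylow : 1 / γ₀ ^ 2 + ((n : ℝ) + 1 - (m + 1 : ℕ)) * β' ≤ y := by
        rw [hy]; push_cast; nlinarith
      have hyγ : 1 / γ₀ ^ 2 ≤ y := by
        have : 0 ≤ ((n : ℝ) + 1 - (m + 1 : ℕ)) * β' := by push_cast; nlinarith
        linarith
      have hypos : 0 < y := lt_of_lt_of_le hγsq hyγ
      have hsucc : g (m + 1) = solveCoupling y := by rw [hg, genSeq_succ]
      have hpos1 : 0 < g (m + 1) := by rw [hsucc]; exact solveCoupling_pos hypos
      have hinv1 : 1 / (g (m + 1)) ^ 2 = y := by rw [hsucc]; exact inv_sq_solveCoupling hypos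
      have hle1 : g (m + 1) ≤ γ₀ :=
        (pow_le_pow_iff_left₀ hpos1.le hγ₀.le two_ne_zero).1 ((one_div_le_one_div (pow_pos hγ₀ 2) (pow_pos hpos1 2)).1 (by rw [hinv1]; exact hyγ))
      refine ⟨fun k hk => ?_, by rw [hinv1]; exact hylow⟩
      rcases Nat.lt_or_ge k (m + 1) with hlt | hge
      · exact hIm k (Nat.lt_succ_iff.mp hlt)
      · obtain rfl : k = m + 1 := le_antisymm hk hge
        exact ⟨hpos1, hle1⟩
  exact (key n le_rfl).1

end Runs

/-! ## §2  Generic: one reference history in the box + history-Lipschitz moduli with summable rows ⟹ the box bound; the run letter supplies the references -/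
section Box

variable {β : HBeta}

/-- Two points of `]0, γ₀]` are within `γ₀` of each other (re-homed `private`). [folklore] -/
private theorem abs_sub_le_of_mem_box' {γ₀ : ℝ} {k : ℕ} {v w : Fin (k + 1) → ℝ} (hv : v ∈ Box γ₀ k) (hw : w ∈ Box γ₀ k) (i : Fin (k + 1)) :
    |v i - w i| ≤ γ₀ := by
  have h1 := mem_box.mp hv i
  have h2 := mem_box.mp hw i
  rw [abs_sub_le_iff]
  constructor <;> linarith

/-- One reference history suffices under history-Lipschitz moduli (re-homed `private`): `|β_k(v)| ≤ |β_k(v⋆)| + γ₀ · Σ_i Λ k i` on `]0, γ₀]^{k+1}`. [cite: Balaban1987RG1, §1 p.264 (bookkeeping)] -/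
private theorem abs_le_of_histLipschitz_of_ref' {Λ : ℕ → ℕ → ℝ} {γ γ₀ : ℝ} (hL : HistLipschitz Λ γ β) (hle : γ₀ ≤ γ) (hΛ : ∀ (k : ℕ) (i : Fin (k + 1)), 0 ≤ Λ k i)
    {k : ℕ} {v w : Fin (k + 1) → ℝ} (hv : v ∈ Box γ₀ k) (hw : w ∈ Box γ₀ k) :
    |β k v| ≤ |β k w| + γ₀ * ∑ i : Fin (k + 1), Λ k i := by
  have hdiff : |β k v - β k w| ≤ ∑ i : Fin (k + 1), Λ k i * |v i - w i| := hL k v w (box_mono hle k hv) (box_mono hle k hw)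
  have hsum : ∑ i : Fin (k + 1), Λ k i * |v i - w i| ≤ ∑ i : Fin (k + 1), Λ k i * γ₀ :=
    Finset.sum_le_sum fun i _ => mul_le_mul_of_nonneg_left (abs_sub_le_of_mem_box' hv hw i) (hΛ k i)
  have hsum' : ∑ i : Fin (k + 1), Λ k i * γ₀ = γ₀ * ∑ i : Fin (k + 1), Λ k i := by rw [Finset.mul_sum]; exact Finset.sum_congr rfl fun i _ => mul_comm _ _
  have htri : |β k v| ≤ |β k w| + |β k v - β k w| := by
    have := abs_add_le (β k w) (β k v - β k w)
    rwa [add_sub_cancel] at this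
  linarith

/-- Fading memory ⟹ k-summable rows (re-homed `private`): `0 ≤ Λ k i ≤ C·ω^{k−i}`, `0 ≤ ω < 1` ⟹ `Σ_{i ≤ k} Λ k i ≤ C/(1−ω)`. [folklore] -/
private theorem sum_histModuli_le_of_fadingMemory' {C ω : ℝ} {Λ : ℕ → ℕ → ℝ} (h : T4CouplingMatching.FadingMemory C ω Λ) (hω0 : 0 ≤ ω) (hω1 : ω < 1) (k : ℕ) :
    ∑ i : Fin (k + 1), Λ k i ≤ C / (1 - ω) := by
  have hC : 0 ≤ C := by have := h k k le_rfl; simpa using this.1.trans this.2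
  have h1 : ∑ i : Fin (k + 1), Λ k i ≤ ∑ i : Fin (k + 1), C * ω ^ (k - (i : ℕ)) :=
    Finset.sum_le_sum fun i _ => (h k i (Nat.lt_succ_iff.mp i.isLt)).2
  have h2 : ∑ i : Fin (k + 1), C * ω ^ (k - (i : ℕ)) = C * ∑ j ∈ range (k + 1), ω ^ j := by
    rw [← Finset.mul_sum, Fin.sum_univ_eq_sum_range (fun i => ω ^ (k - i)) (k + 1), ← Finset.sum_range_reflect (fun j => ω ^ j) (k + 1)]
    congr 1
  have h3 : ∑ j ∈ range (k + 1), ω ^ j ≤ 1 / (1 - ω) := by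
    have := geom_sum_Ico_le_of_lt_one (m := 0) (n := k + 1) hω0 hω1
    rw [pow_zero, ← Finset.range_eq_Ico] at this
    exact this
  calc ∑ i : Fin (k + 1), Λ k i ≤ C * ∑ j ∈ range (k + 1), ω ^ j := h1.trans_eq h2
    _ ≤ C * (1 / (1 - ω)) := mul_le_mul_of_nonneg_left h3 hC
    _ = C / (1 - ω) := by ring

/-- **★ (ii) THE SIGN-FREE BOX FROM THE RUN LETTER AND HISTORY-LIPSCHITZ MODULI WITH k-SUMMABLE ROWS**: the run letter at level `γ₀ > 0` (dag-n07-w3's currency), `HistLipschitz Λ γ β` on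
a box side `γ ≥ γ₀` with `0 ≤ Λ k i` (`i ≤ k`), `Σ_{i≤k} Λ k i ≤ S` for all `k` ⟹ `BetaLowerH (−(β′ + γ₀·S)) γ₀ β ∧ BetaUpperH (β′ + γ₀·S) γ₀ β`.  At level `k` the reference history is
the prefix of an in-window run of length `k` (§1 (i)), where the run letter gives `|β| ≤ β′`; every other box history is within `γ₀` coordinatewise.  CONDITIONAL. [cite: Balaban1987RG1, Thm 3 p.264, §1 p.264 (bookkeeping)] -/
theorem absBetaBox_of_runAbsBound_of_histLipschitz {Λ : ℕ → ℕ → ℝ} {β' γ₀ γ S : ℝ} (hγ₀ : 0 < γ₀)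
    (hrun : ∀ (n : ℕ) (gs : ℕ → ℝ), RGEqH n β gs → Step.InInterval γ₀ n gs → ∀ k, k ≤ n → |β k (prefixOf gs k)| ≤ β')
    (hle : γ₀ ≤ γ) (hL : HistLipschitz Λ γ β) (hΛ : ∀ (k : ℕ) (i : Fin (k + 1)), 0 ≤ Λ k i) (hS : ∀ k, ∑ i : Fin (k + 1), Λ k i ≤ S) :
    BetaLowerH (-(β' + γ₀ * S)) γ₀ β ∧ BetaUpperH (β' + γ₀ * S) γ₀ β := by
  have key : ∀ (k : ℕ) (v : Fin (k + 1) → ℝ), v ∈ Box γ₀ k → |β k v| ≤ β' + γ₀ * S := by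
    intro k v hv
    obtain ⟨g0, hI⟩ := exists_inInterval_genSeq_of_runAbsBound hγ₀ hrun k
    have hw : prefixOf (genSeq β g0) k ∈ Box γ₀ k := mem_box.mpr fun i => hI i (Nat.lt_succ_iff.mp i.isLt)
    have href : |β k (prefixOf (genSeq β g0) k)| ≤ β' := hrun k _ (rgEqH_genSeq_of_inInterval' hI) hI k le_rfl
    have h1 := abs_le_of_histLipschitz_of_ref' hL hle hΛ hv hw
    have h2 : γ₀ * ∑ i : Fin (k + 1), Λ k i ≤ γ₀ * S := mul_le_mul_of_nonneg_left (hS k) hγ₀.le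
    linarith
  exact ⟨fun k v hv => (abs_le.mp (key k v hv)).1, fun k v hv => (abs_le.mp (key k v hv)).2⟩

end Box

/-! ## §3  θ-generic at the record: the run letter + N22's kernel NE9 (fading memory) + the (D4) letter ⟹ the sign-free BOX of `betaOfRecord₁₃ θ` (dag-n22-w3's road BY NAME) -/
section Record

variable (F : T4Family) (N : ℕ) [NeZero N]

/-- **(iii₀) THE SIGN-FREE BOX OF THE β OF RECORD FROM ITS RUN LETTER AND node U2's HISTORY-MODULI LETTER WITH FADING MEMORY** (any `θ`, `0 < γ₀ ≤ θ.γ`): the K2-side currency —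
`HistLipschitz Λ′ θ.γ (betaOfRecord₁₃ θ)` with `T4CouplingMatching.FadingMemory C ω Λ′`, `0 ≤ ω < 1` — plus the run letter (dag-n07-w3's currency) give the box with bound
`β′ + γ₀·C∕(1−ω)`.  CONDITIONAL; nothing asserted. [cite: Balaban1987RG1, §1 p.264, Thm 3 p.264 (bookkeeping)] -/
theorem absBetaBox_betaOfRecord₁₃_of_runAbs_of_histLipschitz (θ : Stage13Params F N) {C ω β' γ₀ : ℝ} {Λ' : ℕ → ℕ → ℝ}
    (hL : HistLipschitz Λ' θ.γ (betaOfRecord₁₃ F N θ)) (hΛ : T4CouplingMatching.FadingMemory C ω Λ') (hω0 : 0 ≤ ω) (hω1 : ω < 1) (hγ₀ : 0 < γ₀) (hle : γ₀ ≤ θ.γ)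
    (hrun : ∀ (n : ℕ) (gs : ℕ → ℝ), RGEqH n (betaOfRecord₁₃ F N θ) gs → Step.InInterval γ₀ n gs → ∀ k, k ≤ n → |betaOfRecord₁₃ F N θ k (prefixOf gs k)| ≤ β') :
    BetaLowerH (-(β' + γ₀ * (C / (1 - ω)))) γ₀ (betaOfRecord₁₃ F N θ) ∧ BetaUpperH (β' + γ₀ * (C / (1 - ω))) γ₀ (betaOfRecord₁₃ F N θ) :=
  absBetaBox_of_runAbsBound_of_histLipschitz hγ₀ hrun hle hL (fun k i => (hΛ k i (Nat.lt_succ_iff.mp i.isLt)).1)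
    (sum_histModuli_le_of_fadingMemory' hΛ hω0 hω1)

/-- **★★ (iii) THE SIGN-FREE BOX OF THE β OF RECORD FROM ITS RUN LETTER AND THE K3∕N22 KERNEL LETTERS** (any `θ : Stage13Params F N`, window `0 < γ₀ ≤ θ.γ`): N22's kernel-currency
NE9 of the functional of record with moduli `Λ` having node-U3 fading memory `FadingMemory C₉ ω Λ` (`0 ≤ ω < 1`), the (D4) letter `KernelDecayOfRecord₁₃ F N θ 0 1 κ` (`0 < κ`) —
whence `HistLipschitz (β′₅₁₀(1,κ)·Λ (k+1) i) θ.γ (betaOfRecord₁₃ θ)` (dag-n22-w3 `histLipschitz_betaOfRecord₁₃_of_kernelNE9`) with rows summing to `≤ β′₅₁₀(1,κ)·C₉·ω∕(1−ω)` — and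
the RUN letter (dag-n07-w3's currency) give `−B ≤ β₁₃(θ) ≤ B` on `]0, γ₀]^{k+1}`, all `k`, with `B = β′ + γ₀·(β′₅₁₀(1,κ)·C₉·ω∕(1−ω))`.  CONDITIONAL on the three displayed letters;
nothing of Bałaban asserted. [cite: Balaban1987RG1, (1.20)–(1.22) p.264, §1 p.264, (5.10) p.293, Thm 3 p.264; Balaban1988RG2Cluster, (2.13)–(2.14) pp.14–15] -/
theorem absBetaBox_betaOfRecord₁₃_of_runAbs_of_kernelNE9 (θ : Stage13Params F N) (ℓ : U3Letters₁₁) {κ C₉ ω β' γ₀ : ℝ} {Λ : ℕ → ℕ → ℝ} (hκ : 0 < κ)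
    (h9 : NE9 ((objectsOfRecord₁₃ F N θ ℓ).EA 0) (Window θ.γ) κ Λ) (hdec : KernelDecayOfRecord₁₃ F N θ 0 1 κ)
    (hΛ : T4OutputRate.FadingMemory C₉ ω Λ) (hω0 : 0 ≤ ω) (hω1 : ω < 1) (hγ₀ : 0 < γ₀) (hle : γ₀ ≤ θ.γ)
    (hrun : ∀ (n : ℕ) (gs : ℕ → ℝ), RGEqH n (betaOfRecord₁₃ F N θ) gs → Step.InInterval γ₀ n gs → ∀ k, k ≤ n → |betaOfRecord₁₃ F N θ k (prefixOf gs k)| ≤ β') :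
    BetaLowerH (-(β' + γ₀ * (betaPrime510 4 1 κ * C₉ * ω / (1 - ω)))) γ₀ (betaOfRecord₁₃ F N θ) ∧
      BetaUpperH (β' + γ₀ * (betaPrime510 4 1 κ * C₉ * ω / (1 - ω))) γ₀ (betaOfRecord₁₃ F N θ) := by
  have hL := histLipschitz_betaOfRecord₁₃_of_kernelNE9 F N θ ℓ hκ h9 hdec
  -- `0 ≤ β′₅₁₀(1, κ)` (a `tsum` of non-negative terms, inlined to keep the import cone small)
  have hP : 0 ≤ betaPrime510 4 1 κ := by
    unfold betaPrime510
    rw [one_mul]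
    exact tsum_nonneg fun x => mul_nonneg (sq_nonneg _) (Real.exp_nonneg _)
  have hFM := fadingMemory_histModuli_of_fadingMemory hP hΛ
  exact absBetaBox_of_runAbsBound_of_histLipschitz hγ₀ hrun hle hL (fun k i => (hFM k i (Nat.lt_succ_iff.mp i.isLt)).1)
    (sum_histModuli_le_of_fadingMemory' hFM hω0 hω1)

end Record

/-! ## §4  At the print-regime Z3 members `θ₁₃ᶜᶜᴹᵂᶻᴮ(j; ½; εbg; …)` (`.γ = ½`): the run letter + the kernel letters ⟹ the door's box; the run CORE + kernel letters ⟹ the BOX CORE -/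
section ZB

/-- **★★ A DOOR's RUN LETTER + THE KERNEL LETTERS AT THE HALF-WINDOW MEMBER ⟹ THE DOOR's BOX**: ✓p771242 §3's `h3R` (some `γ₀, ε₀, ε₂₉ > 0`, `β′` with the run letter of
`β₁₃(θ₁₃ᶜᶜᴹᵂᶻᴮ(j; ½; εbg; ε₀, ε₂₉; …))`) and — at that member — SOME letter block `ℓ`, rate `κ > 0`, moduli `Λ` with node-U3 fading memory `(C₉, ω)`, `0 ≤ ω < 1`, carrying N22's
kernel NE9 on `Window ½` and the (D4) letter, for every pair of thresholds, give `…ZBLam` §4's box hypothesis `h3A` at the same door (window `min γ₀ ½`, §3).  So under the kernel letters the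
run socket and the box socket of a door are ONE debt.  CONDITIONAL; nothing of Bałaban asserted. [cite: Balaban1987RG1, Thm 1 p.259, (1.20)–(1.22) p.264, §1 p.264, Thm 3 p.264, (5.10) p.293; Balaban1988Convergent, Thm 1 p.262] -/
theorem absBoxZBAt_of_runAbsBoxZB_of_kernelLetters (F : T4Family) {j : ℕ} {εbg B₃ B₃' a₀ a₁ : ℝ} {Efl logz : B12.RunParams → ℕ → ℝ}
    (h3R : ∃ γ₀ ε₀ ε₂₉ β' : ℝ, 0 < γ₀ ∧ 0 < ε₀ ∧ 0 < ε₂₉ ∧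
      ∀ (n : ℕ) (gs : ℕ → ℝ), RGEqH n (betaOfRecord₁₃ F 2 (theta13OfThm1CCMWZB F 2 j (1 / 2) εbg ε₀ ε₂₉ B₃ B₃' a₀ a₁ Efl logz)) gs → Step.InInterval γ₀ n gs →
        ∀ k, k ≤ n → |betaOfRecord₁₃ F 2 (theta13OfThm1CCMWZB F 2 j (1 / 2) εbg ε₀ ε₂₉ B₃ B₃' a₀ a₁ Efl logz) k (prefixOf gs k)| ≤ β')
    (hK : ∀ (ε₀ ε₂₉ : ℝ), 0 < ε₀ → 0 < ε₂₉ →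
      ∃ (ℓ : U3Letters₁₁) (κ C₉ ω : ℝ) (Λ : ℕ → ℕ → ℝ), 0 < κ ∧ 0 ≤ ω ∧ ω < 1 ∧
        NE9 ((objectsOfRecord₁₃ F 2 (theta13OfThm1CCMWZB F 2 j (1 / 2) εbg ε₀ ε₂₉ B₃ B₃' a₀ a₁ Efl logz) ℓ).EA 0)
          (Window (theta13OfThm1CCMWZB F 2 j (1 / 2) εbg ε₀ ε₂₉ B₃ B₃' a₀ a₁ Efl logz).γ) κ Λ ∧
        KernelDecayOfRecord₁₃ F 2 (theta13OfThm1CCMWZB F 2 j (1 / 2) εbg ε₀ ε₂₉ B₃ B₃' a₀ a₁ Efl logz) 0 1 κ ∧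
        T4OutputRate.FadingMemory C₉ ω Λ) :
    ∃ γ₀ ε₀ ε₂₉ β' : ℝ, 0 < γ₀ ∧ 0 < ε₀ ∧ 0 < ε₂₉ ∧
      BetaLowerH (-β') γ₀ (betaOfRecord₁₃ F 2 (theta13OfThm1CCMWZB F 2 j (1 / 2) εbg ε₀ ε₂₉ B₃ B₃' a₀ a₁ Efl logz)) ∧
      BetaUpperH β' γ₀ (betaOfRecord₁₃ F 2 (theta13OfThm1CCMWZB F 2 j (1 / 2) εbg ε₀ ε₂₉ B₃ B₃' a₀ a₁ Efl logz)) := by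
  obtain ⟨γ₀, ε₀, ε₂₉, β', hγ₀, hε, hε', hrun⟩ := h3R
  obtain ⟨ℓ, κ, C₉, ω, Λ, hκ, hω0, hω1, h9', hdec, hΛ⟩ := hK ε₀ ε₂₉ hε hε'
  set γ₁ : ℝ := min γ₀ (1 / 2) with hγ₁
  have hγ₁pos : 0 < γ₁ := lt_min hγ₀ (by norm_num)
  have hγ₁le : γ₁ ≤ (theta13OfThm1CCMWZB F 2 j (1 / 2) εbg ε₀ ε₂₉ B₃ B₃' a₀ a₁ Efl logz).γ := by rw [theta13OfThm1CCMWZB_γ]; exact min_le_right _ _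
  obtain ⟨hlow, hup⟩ := absBetaBox_betaOfRecord₁₃_of_runAbs_of_kernelNE9 F 2 _ ℓ hκ h9' hdec hΛ hω0 hω1 hγ₁pos hγ₁le (runAbsBound_mono (min_le_left _ _) hrun)
  exact ⟨γ₁, ε₀, ε₂₉, _, hγ₁pos, hε, hε', hlow, hup⟩

/-- Letter census (`rfl`; = ✓p769914 `K0V23Stub3Sockets.betaOfRecord₁₃_zbRegime_letterBlind`, `private` to stay route-independent): β at the print-regime member reads only `(a₀, ε₂₉)`. [cite: Balaban1987RG1, (1.20)–(1.22) p.264, (2.9) p.266 (bookkeeping)] -/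
private theorem census (F : T4Family) (j j' : ℕ) (a₀ ε₀ ε₀' ε₂₉ B₃ C₃ B₃' C₃' a₁ c₁ : ℝ) (Efl logz Efl' logz' : B12.RunParams → ℕ → ℝ) :
    betaOfRecord₁₃ F 2 (theta13OfThm1CCMWZB F 2 j (1 / 2) a₀ ε₀ ε₂₉ B₃ B₃' a₀ a₁ Efl logz) =
      betaOfRecord₁₃ F 2 (theta13OfThm1CCMWZB F 2 j' (1 / 2) a₀ ε₀' ε₂₉ C₃ C₃' a₀ c₁ Efl' logz') := rfl

/-- **★★★ THE RUN-WISE CORE + THE KERNEL LETTERS AT ONE MEMBER PER `(a₀, ε₂₉)` ⟹ THE BOX CORE** — the converse of ✓p771242 §5 `runwiseZB_of_tokenFreeZB` modulo the K3∕N22 letters: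
dag-n07-w3's run core «∀ a₀ > 0, ∃ γ₀ ε₂₉ β′, run letter of β₁₃(F; a₀, ε₂₉) at level γ₀» together with, for every radius `a₀ > 0` and threshold `ε₂₉ > 0`, the kernel letters
(NE9 on `Window ½` + (D4) + fading memory) at SOME print-regime member `θ₁₃ᶜᶜᴹᵂᶻᴮ(j; ½; a₀; ε₀, ε₂₉; B₃, B₃′, a₀, a₁; Efl, logz)` (any letters — β is blind to them, census) gives the
BOX core of ✓p770586∕p770587 (`tokenFreeZB`: «∀ a₀ > 0, ∃ γ₀ ε₂₉ β′, the sign-free box of β₁₃(F; a₀, ε₂₉) on ]0, γ₀]»), window `min γ₀ ½`.  CONDITIONAL on both displayed inputs;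
stub 3ᴬ′ᴮ NOT proved; nothing of Bałaban asserted. [cite: Balaban1987RG1, Thm 3 p.264, §1 p.264, (1.20)–(1.22) p.264, (5.10) p.293; Balaban1988RG2Cluster, (2.13)–(2.14) pp.14–15] -/
theorem tokenFreeZB_of_runwiseZB_of_kernelLettersAt (F : T4Family)
    (run : ∀ a₀ : ℝ, 0 < a₀ → ∃ γ₀ ε₂₉ β' : ℝ, 0 < γ₀ ∧ 0 < ε₂₉ ∧ ∀ (j : ℕ) (ε₀ B₃ B₃' a₁ : ℝ),
      ∀ (n : ℕ) (gs : ℕ → ℝ), RGEqH n (betaOfRecord₁₃ F 2 (theta13OfThm1CCMWZB F 2 j (1 / 2) a₀ ε₀ ε₂₉ B₃ B₃' a₀ a₁ (fun _ _ => 0) (fun _ _ => 0))) gs → Step.InInterval γ₀ n gs →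
        ∀ k, k ≤ n → |betaOfRecord₁₃ F 2 (theta13OfThm1CCMWZB F 2 j (1 / 2) a₀ ε₀ ε₂₉ B₃ B₃' a₀ a₁ (fun _ _ => 0) (fun _ _ => 0)) k (prefixOf gs k)| ≤ β')
    (hK : ∀ (a₀ ε₂₉ : ℝ), 0 < a₀ → 0 < ε₂₉ →
      ∃ (j : ℕ) (ε₀ B₃ B₃' a₁ : ℝ) (Efl logz : B12.RunParams → ℕ → ℝ) (ℓ : U3Letters₁₁) (κ C₉ ω : ℝ) (Λ : ℕ → ℕ → ℝ), 0 < κ ∧ 0 ≤ ω ∧ ω < 1 ∧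
        NE9 ((objectsOfRecord₁₃ F 2 (theta13OfThm1CCMWZB F 2 j (1 / 2) a₀ ε₀ ε₂₉ B₃ B₃' a₀ a₁ Efl logz) ℓ).EA 0)
          (Window (theta13OfThm1CCMWZB F 2 j (1 / 2) a₀ ε₀ ε₂₉ B₃ B₃' a₀ a₁ Efl logz).γ) κ Λ ∧
        KernelDecayOfRecord₁₃ F 2 (theta13OfThm1CCMWZB F 2 j (1 / 2) a₀ ε₀ ε₂₉ B₃ B₃' a₀ a₁ Efl logz) 0 1 κ ∧
        T4OutputRate.FadingMemory C₉ ω Λ) :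
    ∀ a₀ : ℝ, 0 < a₀ → ∃ γ₀ ε₂₉ β' : ℝ, 0 < γ₀ ∧ 0 < ε₂₉ ∧ ∀ (j : ℕ) (ε₀ B₃ B₃' a₁ : ℝ),
      BetaLowerH (-β') γ₀ (betaOfRecord₁₃ F 2 (theta13OfThm1CCMWZB F 2 j (1 / 2) a₀ ε₀ ε₂₉ B₃ B₃' a₀ a₁ (fun _ _ => 0) (fun _ _ => 0))) ∧
      BetaUpperH β' γ₀ (betaOfRecord₁₃ F 2 (theta13OfThm1CCMWZB F 2 j (1 / 2) a₀ ε₀ ε₂₉ B₃ B₃' a₀ a₁ (fun _ _ => 0) (fun _ _ => 0))) := by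
  intro a₀ ha₀
  obtain ⟨γ₀, ε₂₉, β', hγ₀, hε', hall⟩ := run a₀ ha₀
  obtain ⟨j, ε₀, B₃, B₃', a₁, Efl, logz, ℓ, κ, C₉, ω, Λ, hκ, hω0, hω1, h9', hdec, hΛ⟩ := hK a₀ ε₂₉ ha₀ hε'
  set γ₁ : ℝ := min γ₀ (1 / 2) with hγ₁
  have hγ₁pos : 0 < γ₁ := lt_min hγ₀ (by norm_num)
  have hγ₁le : γ₁ ≤ (theta13OfThm1CCMWZB F 2 j (1 / 2) a₀ ε₀ ε₂₉ B₃ B₃' a₀ a₁ Efl logz).γ := by rw [theta13OfThm1CCMWZB_γ]; exact min_le_right _ _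
  have hrun : ∀ (n : ℕ) (gs : ℕ → ℝ), RGEqH n (betaOfRecord₁₃ F 2 (theta13OfThm1CCMWZB F 2 j (1 / 2) a₀ ε₀ ε₂₉ B₃ B₃' a₀ a₁ Efl logz)) gs → Step.InInterval γ₁ n gs →
      ∀ k, k ≤ n → |betaOfRecord₁₃ F 2 (theta13OfThm1CCMWZB F 2 j (1 / 2) a₀ ε₀ ε₂₉ B₃ B₃' a₀ a₁ Efl logz) k (prefixOf gs k)| ≤ β' := by
    rw [← census F 0 j a₀ a₀ ε₀ ε₂₉ 0 B₃ 0 B₃' a₀ a₁ (fun _ _ => 0) (fun _ _ => 0) Efl logz]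
    exact runAbsBound_mono (min_le_left _ _) (hall 0 a₀ 0 0 a₀)
  obtain ⟨hlow, hup⟩ := absBetaBox_betaOfRecord₁₃_of_runAbs_of_kernelNE9 F 2 _ ℓ hκ h9' hdec hΛ hω0 hω1 hγ₁pos hγ₁le hrun
  refine ⟨γ₁, ε₂₉, β' + γ₁ * (betaPrime510 4 1 κ * C₉ * ω / (1 - ω)), hγ₁pos, hε', fun j' ε₀' C₃ C₃' c₁' => ?_⟩
  rw [census F j' j a₀ ε₀' ε₀ ε₂₉ C₃ B₃ C₃' B₃' c₁' a₁ (fun _ _ => 0) (fun _ _ => 0) Efl logz]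
  exact ⟨hlow, hup⟩

end ZB

/-! ## §5  … AND NOT WITHOUT LETTERS: a history family bounded (by `0`) along every in-window run of (0.20) yet unbounded on every box — the converse NEEDS regularity -/
section Sharpness

/-- **★ THE RUN LETTER IS STRICTLY WEAKER THAN THE BOX IN GENERAL** (generic `HBeta`; no kernel letters): the family `β₀ ≡ 0`, `β₁(g₀, g₁) = |g₁ − g₀|⁻¹` (Lean's `0⁻¹ = 0`), `β_k ≡ 0`
(`k ≥ 2`) satisfies the run letter with `β′ = 0` on EVERY window — along a solution of (0.20) `g₁ = g₀` exactly, where `β₁` vanishes — but `β₁` is unbounded above on every box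
`]0, γ₀]²`.  So «runs ⟹ box» is false for a bare `HBeta`; §2–§4 buy it with history-Lipschitz moduli (N22's NE9 + (D4) at the record).  Elementary; nothing about Bałaban's β.
[cite: Balaban1987RG1, (0.20) p.256, Thm 3 p.264 (bookkeeping)] -/
theorem exists_hbeta_runAbs_not_box :
    ∃ β : HBeta, (∀ (γ₀ : ℝ) (n : ℕ) (gs : ℕ → ℝ), RGEqH n β gs → Step.InInterval γ₀ n gs → ∀ k, k ≤ n → |β k (prefixOf gs k)| ≤ 0) ∧
      ∀ γ₀ B : ℝ, 0 < γ₀ → ¬ BetaUpperH B γ₀ β := by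
  refine ⟨fun k v => if h : k = 1 then |v ⟨1, by omega⟩ - v ⟨0, by omega⟩|⁻¹ else 0, ?_, ?_⟩
  · intro γ₀ n gs hrg hI k hk
    by_cases h1 : k = 1
    · subst h1
      have h0 := hrg 0 (by omega)
      simp only [zero_add, Nat.zero_ne_one, ↓reduceDIte, add_zero] at h0
      have hg0 := (hI 0 (by omega)).1
      have hg1 := (hI 1 hk).1
      have hsq : gs 0 ^ 2 = gs 1 ^ 2 := by
        have h0' : (gs 0 ^ 2)⁻¹ = (gs 1 ^ 2)⁻¹ := by simpa [one_div] using h0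
        exact inv_inj.mp h0'
      have heq : gs 0 = gs 1 := (pow_left_inj₀ hg0.le hg1.le two_ne_zero).mp hsq
      simp [prefixOf, heq]
    · simp [h1]
  · intro γ₀ B hγ₀ hup
    set δ : ℝ := min (γ₀ / 2) (1 / (|B| + 1)) with hδ
    have hB1 : 0 < |B| + 1 := by positivity
    have hδpos : 0 < δ := lt_min (by positivity) (by positivity)
    have hδle : δ ≤ γ₀ / 2 := min_le_left _ _
    have hδle' : δ ≤ 1 / (|B| + 1) := min_le_right _ _
    -- the level-1 box history `(γ₀, γ₀ − δ)`
    have hvbox : (fun i : Fin (1 + 1) => γ₀ - δ * (i : ℕ)) ∈ Box γ₀ 1 := by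
      refine mem_box.mpr fun i => ?_
      have hi : ((i : ℕ) : ℝ) ≤ 1 := by exact_mod_cast Nat.lt_succ_iff.mp i.isLt
      have hi0 : (0 : ℝ) ≤ ((i : ℕ) : ℝ) := by exact_mod_cast Nat.zero_le _
      constructor <;> nlinarith
    have hval := hup 1 _ hvbox
    have h10 : (fun i : Fin (1 + 1) => γ₀ - δ * (i : ℕ)) ⟨1, by omega⟩ - (fun i : Fin (1 + 1) => γ₀ - δ * (i : ℕ)) ⟨0, by omega⟩ = -δ := by
      push_cast
      ring
    simp only [↓reduceDIte] at hval
    rw [h10, abs_neg, abs_of_pos hδpos] at hval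
    -- `δ⁻¹ ≥ |B| + 1 > B`
    have hinv : |B| + 1 ≤ δ⁻¹ := by
      rw [le_inv_comm₀ hB1 hδpos]
      simpa [one_div] using hδle'
    have : B < δ⁻¹ := lt_of_lt_of_le (lt_of_le_of_lt (le_abs_self B) (lt_add_one _)) hinv
    linarith

end Sharpness

end Summit.QuantumFields.YangMills.Theorems.K0V23Stub3RunBoxEquivalence

end
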